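import Literature.MathematicalPhysics.QuantumFieldTheory.QCDFlavourSymmetry
import Literature.MathematicalPhysics.QuantumFieldTheory.QCDHeavyQuarkPropagator
import Literature.MathematicalPhysics.QuantumFieldTheory.QCDWickMinorMeasurability
import Literature.MathematicalPhysics.QuantumFieldTheory.FermiFlavourPhase
import Literature.MathematicalPhysics.QuantumLattice.GrassmannGaussianWordWick
import Summits.QuantumFields.QCD.Theorems.PauliWegnerSeaPhaseQuenchedFlavourDecayStubWickExpansion
import HarnessLib

/-!
# Crux `TorusHalfSpectrum` (stmt-QuantumFields-9508), line `registered` (`Lines/birth.lean`, reshape v3) —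
# stub `stub_conjugate_heavy_pathwise`: the configuration-wise hopping bound for conjugate charged pairs

Stub P of the birth skeleton of the crux
`Summit.QuantumFields.QCD.Theses.QuarksNoInfraredClause.TorusHalfSpectrum` (= `HeavyPathwiseStmt`
unfolded): for a pair of gauge-invariant local lattice-QCD observables `A`, `B` which are HOMOGENEOUS of
opposite non-zero flavour charge vectors `q`, `-q` under the vector flavour torus
(`QCDLatticeObservable.flavourScale`), and bare Wilson masses `m_f ≥ m₀ > 0`, there is a constant `K`
(depending on `A, B, q, m₀, R, R'` only) such that on every torus of side `2S+1 > 2(R+R')+1`, for every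
`SU(3)` gauge field `U` and every Euclidean time `n ≤ S`,
`‖∫dψ̄dψ A(0) B(n e₀) e^{-ψ̄D(U)ψ}‖ ≤ K (4/(m₀+4))ⁿ ‖∫dψ̄dψ e^{-ψ̄D(U)ψ}‖`.

Proof.
* `isFlavourCharged_of_homogeneous`: a homogeneous observable of charge vector `q` has `U(1)_{f₀}`
  charge `q f₀` (`QCDLatticeObservable.IsFlavourCharged`, file `FermiFlavourPhase.lean`): the flavour-`f₀`
  rotation by `θ` is the torus element `(1, …, e^{iθ}, …, 1)`.  Pick `f₀` with `q f₀ ≠ 0`.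
* Wick's theorem in determinant form as a deterministic bound (the tree's
  `CrossingSplitIntegrability.stub_wickExpansion`, built on `GrassmannMonomialCoefficients.lean` and
  `GrassmannGaussianWordWick.lean`): `‖∫ A(0)B(n e₀) e^{-ψ̄Dψ} / ∫ e^{-ψ̄Dψ}‖ ≤ Σ_i c_i ‖det M_i(U)‖` for a
  FIXED finite family of Wick patterns (rows = `ψ`-letters, columns = `ψ̄`-letters of the two boxes, the
  `A`-box placed at time `0`, the `B`-box at time `n`), every pattern with non-zero `A`-side `f₀`-charge,
  weights `c_i ≥ 0` independent of `S, U, m, n`; and `∫ e^{-ψ̄Dψ} = ± det(-D) ≠ 0` for positive masses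
  (`berezin_grassmannExp_quadratic_holds`, `det_diracMatrix_ne_zero_of_pos`).
* `norm_det_le_of_card_ne` (Leibniz expansion `Matrix.det_apply'`): in a pattern whose `A`-side is charged,
  EVERY permutation `σ` pairs some column with a row of another flavour — a vanishing propagator entry,
  `inv_diracMatrix_apply_eq_zero_of_fst_ne` — or of the other box (`exists_mismatch_of_card_ne`: otherwise
  `σ` would match the `A`-side `f₀`-rows with the `A`-side `f₀`-columns, `Finset.card_equiv`); a cross-box
  entry joins time coordinates `u ∈ [-R, R]` and `u' + n`, `u' ∈ [-R', R']`, whose cyclic distance on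
  `ℤ/(2S+1)` is `≥ n - R - R'` for `n ≤ S` (`le_add_natAbs_valMinAbs_of_abs_add_le`), so it is
  `≤ m₀⁻¹ θ^{n-R-R'}`, `θ = 4/(m₀+4)` (`norm_inv_diracMatrix_apply_le_of_le`, time axis `i = 0`), and every
  entry is `≤ m₀⁻¹`; hence `‖det M_i‖ ≤ r_i! m₀^{-r_i} θⁿ/θ^{R+R'}` and
  `K = (Σ_i c_i r_i! m₀^{-r_i}) / θ^{R+R'}`.

Everything used is proved in the tree (no named fact).  Sources: I. Montvay, G. Münster, *Quantum Fields
on a Lattice* (CUP 1994), §4.1.3 (4.25) (Wick rule), §5.1.1 (5.6) (flavour symmetry), §5.1.2 (hopping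
parameter expansion); V. Mastropietro, *Non-Perturbative Renormalization* (2008), Ch. 2 (2.12), (2.30).
-/

noncomputable section

namespace Summit.QuantumFields.QCD.Cruxes.TorusHalfSpectrum.Birth.ConjugateHeavyPathwise

open scoped BigOperators
open Literature.MathematicalPhysics.QuantumFieldTheory Literature.MathematicalPhysics.QuantumLattice
  Literature.Probability.LatticeModels

variable {Nf : ℕ}

/-- **A homogeneous observable of charge vector `q` has `U(1)_{f₀}` charge `q f₀`** for every flavour
`f₀`: the flavour-`f₀` rotation by `θ` is the torus element `t = (1, …, e^{iθ}, …, 1)`. -/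
theorem isFlavourCharged_of_homogeneous {R : ℕ} (A : QCDLatticeObservable Nf R) {q : Fin Nf → ℤ}
    (hA : ∀ t : Fin Nf → ℂ, (∀ f, t f ≠ 0) → ∀ U,
      QCDLatticeObservable.flavourScale t (A.F U) = (∏ f, t f ^ (q f)) • A.F U) (f₀ : Fin Nf) :
    A.IsFlavourCharged f₀ (q f₀) := by
  intro θ U
  set t : Fin Nf → ℂ := Function.update 1 f₀ (Complex.exp ((θ : ℂ) * Complex.I)) with ht_def
  have ht0 : t f₀ = Complex.exp ((θ : ℂ) * Complex.I) := by simp [ht_def]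
  have ht1 : ∀ f, f ≠ f₀ → t f = 1 := fun f hf => by simp [ht_def, Function.update_of_ne hf]
  have htf : ∀ f, t f = if f = f₀ then Complex.exp ((θ : ℂ) * Complex.I) else 1 := fun f => by
    by_cases h : f = f₀
    · rw [if_pos h, h, ht0]
    · rw [if_neg h, ht1 f h]
  have ht : ∀ f, t f ≠ 0 := fun f => by
    rw [htf]
    split_ifs
    · exact Complex.exp_ne_zero _
    · exact one_ne_zero
  have hmap : fermiFlavourPhase (R := R) f₀ θ = QCDLatticeObservable.flavourScale t := by
    rw [fermiFlavourPhase_eq, grassmannRescale, QCDLatticeObservable.flavourScale_eq, grassmannRescaleLin]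
    congr 1
    refine LinearMap.ext fun x => funext fun w => ?_
    simp only [LinearMap.pi_apply, LinearMap.smul_apply, LinearMap.proj_apply, smul_eq_mul]
    congr 1
    induction w using lex_sum_ind with
    | hl a =>
      rw [flavourPhaseWeight_inl, QCDLatticeObservable.flavourWeight_inl, htf, boxFlavour]
      split_ifs
      · rw [← Complex.exp_neg]
      · rw [inv_one]
    | hr b =>
      rw [flavourPhaseWeight_inr, QCDLatticeObservable.flavourWeight_inr, htf, boxFlavour]
  have hchar : (∏ f, t f ^ (q f)) = Complex.exp ((((q f₀ : ℤ) : ℝ) * θ : ℝ) * Complex.I) := by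
    rw [Finset.prod_eq_single f₀ (fun f _ hf => by rw [ht1 f hf, one_zpow]) (fun h => absurd
      (Finset.mem_univ f₀) h), ht0, ← Complex.exp_int_mul]
    push_cast
    ring_nf
  rw [hmap, hA t ht U, hchar]

/-! ### Cyclic time distances across the gap -/

/-- On the torus of side `2S+1`: if `n ≤ S` and the integer `z` is within `R₀` of `-n`, then the cyclic
distance of the residue of `z` to `0` is at least `n - R₀`. -/
theorem le_add_natAbs_valMinAbs_of_abs_add_le {S n R₀ : ℕ} (hn : n ≤ S) (z : ℤ)
    (hz : |z + n| ≤ R₀) : n ≤ R₀ + ((z : ZMod (2 * S + 1))).valMinAbs.natAbs := by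
  set m : ℤ := ((z : ZMod (2 * S + 1))).valMinAbs with hm
  have hmz : ((m : ℤ) : ZMod (2 * S + 1)) = (z : ZMod (2 * S + 1)) := ZMod.coe_valMinAbs _
  have hdvd : ((2 * S + 1 : ℕ) : ℤ) ∣ z - m := (ZMod.intCast_eq_intCast_iff_dvd_sub m z _).1 hmz
  have hmle : m.natAbs ≤ S := by
    have h := ZMod.natAbs_valMinAbs_le (n := 2 * S + 1) (z : ZMod (2 * S + 1))
    rw [← hm] at h
    omega
  obtain ⟨t, ht⟩ := hdvd
  have habs := abs_le.1 hz
  have hmabs : -(m.natAbs : ℤ) ≤ m ∧ m ≤ m.natAbs := by omega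
  suffices h : (n : ℤ) ≤ R₀ + m.natAbs by exact_mod_cast h
  rcases lt_trichotomy t 0 with h | h | h
  · have h1 : t ≤ -1 := by omega
    have h2 : z - m ≤ -((2 * S + 1 : ℕ) : ℤ) := by rw [ht]; nlinarith
    push_cast at h2
    omega
  · subst h
    have h2 : z = m := by rw [mul_zero] at ht; omega
    omega
  · have h1 : 1 ≤ t := by omega
    have h2 : ((2 * S + 1 : ℕ) : ℤ) ≤ z - m := by rw [ht]; nlinarith
    push_cast at h2
    omega

/-- The same with `z` within `R₀` of `+n` (the cyclic distance is even). -/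
theorem le_add_natAbs_valMinAbs_of_abs_sub_le {S n R₀ : ℕ} (hn : n ≤ S) (z : ℤ)
    (hz : |z - n| ≤ R₀) : n ≤ R₀ + ((z : ZMod (2 * S + 1))).valMinAbs.natAbs := by
  have h := le_add_natAbs_valMinAbs_of_abs_add_le (R₀ := R₀) hn (-z)
    (by rw [← abs_neg]; convert hz using 2; ring)
  rwa [Int.cast_neg, ZMod.natAbs_valMinAbs_neg] at h

/-! ### Leibniz bound for a Wick minor with a charged side -/

/-- **Every permutation of a charged Wick pattern has a bad factor.**  Rows `a` (the `ψ`-letters) and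
columns `b` (the `ψ̄`-letters) of a Wick minor carry a side and a flavour; if on the `true` side the number
of rows of flavour `f₀` differs from the number of columns of flavour `f₀`, then every permutation `σ`
pairs some column with a row of a different flavour or of a different side. -/
theorem exists_mismatch_of_card_ne {r : ℕ} {V F : Type*} (κ ρ : Fin r → V) (side : V → Bool)
    (fl : V → F) (f₀ : F) [DecidablePred fun a => side (κ a) = true ∧ fl (κ a) = f₀]
    [DecidablePred fun b => side (ρ b) = true ∧ fl (ρ b) = f₀]
    (hch : (Finset.univ.filter fun a => side (κ a) = true ∧ fl (κ a) = f₀).card ≠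
      (Finset.univ.filter fun b => side (ρ b) = true ∧ fl (ρ b) = f₀).card)
    (σ : Equiv.Perm (Fin r)) :
    ∃ b, fl (κ (σ b)) ≠ fl (ρ b) ∨ side (κ (σ b)) ≠ side (ρ b) := by
  by_contra h
  push Not at h
  refine hch (Finset.card_equiv σ fun b => ?_).symm
  simp only [Finset.mem_filter, Finset.mem_univ, true_and, (h b).1, (h b).2]

/-- **Leibniz bound for a Wick minor with a charged side**: if every entry is bounded by `c₀ ≥ 0`,
entries between different flavours vanish, entries between different sides are bounded by `ε c₀`
(`ε ≥ 0`), and the `true` side is charged (`#rows ≠ #columns` of flavour `f₀` there), then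
`‖det M‖ ≤ r! · ε · c₀ ^ r` (Leibniz expansion; every permutation has a cross-side factor or vanishes). -/
theorem norm_det_le_of_card_ne {r : ℕ} {V F : Type*} (M : Matrix (Fin r) (Fin r) ℂ) (κ ρ : Fin r → V)
    (side : V → Bool) (fl : V → F) (f₀ : F) [DecidablePred fun a => side (κ a) = true ∧ fl (κ a) = f₀]
    [DecidablePred fun b => side (ρ b) = true ∧ fl (ρ b) = f₀] {c₀ ε : ℝ} (hc₀ : 0 ≤ c₀) (hε : 0 ≤ ε)
    (hfl : ∀ a b, fl (κ a) ≠ fl (ρ b) → M a b = 0) (hall : ∀ a b, ‖M a b‖ ≤ c₀)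
    (hcross : ∀ a b, side (κ a) ≠ side (ρ b) → ‖M a b‖ ≤ ε * c₀)
    (hch : (Finset.univ.filter fun a => side (κ a) = true ∧ fl (κ a) = f₀).card ≠
      (Finset.univ.filter fun b => side (ρ b) = true ∧ fl (ρ b) = f₀).card) :
    ‖M.det‖ ≤ (r.factorial : ℝ) * (ε * c₀ ^ r) := by
  classical
  rw [Matrix.det_apply']
  refine (norm_sum_le _ _).trans ?_
  have key : ∀ σ : Equiv.Perm (Fin r),
      ‖((Equiv.Perm.sign σ : ℤ) : ℂ) * ∏ i, M (σ i) i‖ ≤ ε * c₀ ^ r := by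
    intro σ
    have hsign : ‖((Equiv.Perm.sign σ : ℤ) : ℂ)‖ = 1 := by
      rcases Int.units_eq_one_or (Equiv.Perm.sign σ) with h | h <;> simp [h]
    rw [norm_mul, hsign, one_mul, norm_prod]
    obtain ⟨b, hb⟩ := exists_mismatch_of_card_ne κ ρ side fl f₀ hch σ
    rw [← Finset.mul_prod_erase _ _ (Finset.mem_univ b)]
    have hrest : ∏ i ∈ Finset.univ.erase b, ‖M (σ i) i‖ ≤ c₀ ^ (r - 1) := by
      refine (Finset.prod_le_prod (fun i _ => norm_nonneg _) fun i _ => hall _ _).trans_eq ?_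
      rw [Finset.prod_const, Finset.card_erase_of_mem (Finset.mem_univ b), Finset.card_univ,
        Fintype.card_fin]
    have hb' : ‖M (σ b) b‖ ≤ ε * c₀ := by
      rcases hb with h | h
      · rw [hfl _ _ h, norm_zero]; exact mul_nonneg hε hc₀
      · exact hcross _ _ h
    have hr : c₀ ^ r = c₀ * c₀ ^ (r - 1) := by
      rw [← pow_succ', Nat.sub_add_cancel (Nat.one_le_iff_ne_zero.2 (Nat.pos_iff_ne_zero.1 b.pos))]
    rw [hr, ← mul_assoc]
    exact mul_le_mul hb' hrest (Finset.prod_nonneg fun _ _ => norm_nonneg _) (mul_nonneg hε hc₀)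
  refine (Finset.sum_le_sum fun σ _ => key σ).trans_eq ?_
  rw [Finset.sum_const, Finset.card_univ, Fintype.card_perm, Fintype.card_fin, nsmul_eq_mul]

/-! ### Entries of the heavy-quark propagator -/

section Propagator

variable {S : ℕ} [NeZero S]

/-- **Heavy-quark bound for an arbitrary pair of quark variables**: for bare masses `≥ m₀ > 0`,
`‖D(U)⁻¹(v, w)‖ ≤ m₀⁻¹ (4/(m₀+4))^{d₀(v,w)}`, `d₀` the cyclic distance of the time coordinates (an
entry between different flavours vanishes). -/
theorem norm_inv_diracMatrix_apply_le_time (U : GaugeConfig 4 S (Matrix.specialUnitaryGroup (Fin 3) ℂ))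
    (mq : Fin Nf → ℝ) {m₀ : ℝ} (hm₀ : 0 < m₀) (hM : ∀ f, m₀ ≤ mq f) (v w : QuarkVar Nf S) :
    ‖(diracMatrix U mq)⁻¹ (quarkEquiv v) (quarkEquiv w)‖ ≤
      m₀⁻¹ * (4 / (m₀ + 4)) ^ (v.2.1 0 - w.2.1 0).valMinAbs.natAbs := by
  by_cases h : v.1 = w.1
  · obtain ⟨f, p⟩ := v
    obtain ⟨g, p'⟩ := w
    dsimp only at h
    subst h
    exact norm_inv_diracMatrix_apply_le_of_le U mq hm₀ hM f p p' 0
  · rw [inv_diracMatrix_apply_eq_zero_of_fst_ne U mq h, norm_zero]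
    have : 0 ≤ 4 / (m₀ + 4) := by positivity
    positivity

/-- Hence every entry is bounded by `m₀⁻¹`. -/
theorem norm_inv_diracMatrix_apply_le_inv (U : GaugeConfig 4 S (Matrix.specialUnitaryGroup (Fin 3) ℂ))
    (mq : Fin Nf → ℝ) {m₀ : ℝ} (hm₀ : 0 < m₀) (hM : ∀ f, m₀ ≤ mq f) (v w : QuarkVar Nf S) :
    ‖(diracMatrix U mq)⁻¹ (quarkEquiv v) (quarkEquiv w)‖ ≤ m₀⁻¹ := by
  refine (norm_inv_diracMatrix_apply_le_time U mq hm₀ hM v w).trans ?_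
  have h0 : (0 : ℝ) ≤ 4 / (m₀ + 4) := by positivity
  have h1 : 4 / (m₀ + 4) ≤ (1 : ℝ) := by rw [div_le_one (by positivity)]; linarith
  exact mul_le_of_le_one_right (inv_nonneg.2 hm₀.le) (pow_le_one₀ h0 h1)

end Propagator

/-! ### The registered stub -/

open Summit.QuantumFields.QCD.Cruxes.PhaseQuenchedFlavourDecay.CrossingSplitIntegrability
  (stub_wickExpansion)

/-- **Stub `stub_conjugate_heavy_pathwise` of the birth skeleton of `TorusHalfSpectrum`
(= `HeavyPathwiseStmt`)**: configuration-wise hopping bound for conjugate charged pairs in the heavy-mass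
corner.  Wick expansion in determinant form (`stub_wickExpansion`, every term with non-zero A-side
`f₀`-charge, `q f₀ ≠ 0`), `det D ≠ 0` for positive masses, and the Leibniz bound
`norm_det_le_of_card_ne`: every permutation of a charged pattern has a flavour mismatch (factor `0`) or a
quark line across the time gap (factor `≤ m₀⁻¹ θ^{n-R-R'}`, `θ = 4/(m₀+4)`,
`norm_inv_diracMatrix_apply_le_of_le`), all other factors `≤ m₀⁻¹`. -/
theorem stub_conjugate_heavy_pathwise :
    ∀ (Nf R R' : ℕ) (A : QCDLatticeObservable Nf R) (B : QCDLatticeObservable Nf R') (q : Fin Nf → ℤ)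
      (m₀ : ℝ), 0 < m₀ →
      (∀ t : Fin Nf → ℂ, (∀ f, t f ≠ 0) → ∀ U,
          QCDLatticeObservable.flavourScale t (A.F U) = (∏ f, t f ^ (q f)) • A.F U) →
      (∀ t : Fin Nf → ℂ, (∀ f, t f ≠ 0) → ∀ U,
          QCDLatticeObservable.flavourScale t (B.F U) = (∏ f, t f ^ ((-q) f)) • B.F U) →
      q ≠ 0 →
        ∃ K : ℝ, ∀ (S : ℕ), R + R' < S → ∀ (mq : Fin Nf → ℝ), (∀ f, m₀ ≤ mq f) →
          ∀ (U : GaugeConfig 4 (2 * S + 1) (Matrix.specialUnitaryGroup (Fin 3) ℂ)) (n : ℕ), n ≤ S →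
            ‖fermiIntegral (A.onTorus (2 * S + 1) 0 U * B.onTorus (2 * S + 1) (Pi.single 0 (n : ℤ)) U *
                fermiBoltzmann U mq)‖ ≤
              K * (4 / (m₀ + 4)) ^ n * ‖fermiIntegral (fermiBoltzmann U mq)‖ := by
  intro Nf R R' A B q m₀ hm₀ hA _hB hq
  obtain ⟨f₀, hf₀⟩ := Function.ne_iff.1 hq
  obtain ⟨ι, _, r, κ, ρ, c, hc, hch, hbound⟩ :=
    stub_wickExpansion Nf R R' A B f₀ (q f₀) hf₀ (isFlavourCharged_of_homogeneous A hA f₀)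
  set θ : ℝ := 4 / (m₀ + 4) with hθ
  have hθ0 : 0 < θ := by positivity
  have hθ1 : θ ≤ 1 := by rw [hθ, div_le_one (by positivity)]; linarith
  refine ⟨(∑ i, c i * ((r i).factorial * m₀⁻¹ ^ (r i))) / θ ^ (R + R'), ?_⟩
  intro S hS mq hmq U n hn
  have h1 := hbound S n mq U
  set P : BoxQuarkVar Nf R ⊕ BoxQuarkVar Nf R' → QuarkVar Nf (2 * S + 1) := Sum.elim
      (fun v : BoxQuarkVar Nf R =>
        (v.1, (Torus.proj (2 * S + 1) (v.2.1 : Literature.Probability.LatticeModels.Site 4), v.2.2)))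
      (fun v : BoxQuarkVar Nf R' =>
        (v.1, (Torus.proj (2 * S + 1)
          ((v.2.1 : Literature.Probability.LatticeModels.Site 4) + Pi.single 0 (n : ℤ)), v.2.2))) with hP
  have hpos : ∀ f, 0 < mq f := fun f => hm₀.trans_le (hmq f)
  have hden : fermiIntegral (fermiBoltzmann U mq) ≠ 0 := by
    rw [fermiIntegral, fermiBoltzmann, berezin_grassmannExp_quadratic_holds ℂ (-diracMatrix U mq),
      Matrix.det_neg]
    exact mul_ne_zero (pow_ne_zero _ (neg_ne_zero.2 one_ne_zero))
      (mul_ne_zero (pow_ne_zero _ (neg_ne_zero.2 one_ne_zero)) (det_diracMatrix_ne_zero_of_pos U mq hpos))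
  set ε : ℝ := θ ^ n / θ ^ (R + R') with hε
  have hε0 : 0 ≤ ε := by positivity
  -- flavour and time coordinate of the placed variables
  have hP1 : ∀ v, (P v).1 = Sum.elim (fun v : BoxQuarkVar Nf R => v.1) (fun v : BoxQuarkVar Nf R' => v.1) v := by
    rintro (v | v) <;> rfl
  have htime : ∀ v w, Sum.isLeft v ≠ Sum.isLeft w →
      n ≤ (R + R') + ((P v).2.1 0 - (P w).2.1 0).valMinAbs.natAbs := by
    rintro (v | v) (w | w) hvw
    · simp at hvw
    · have hv := (mem_box.1 v.2.1.2) 0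
      have hw := (mem_box.1 w.2.1.2) 0
      have hz : ((P (Sum.inl v)).2.1 0 - (P (Sum.inr w)).2.1 0) =
          (((v.2.1 : Literature.Probability.LatticeModels.Site 4) 0 -
            ((w.2.1 : Literature.Probability.LatticeModels.Site 4) 0 + n) : ℤ) : ZMod (2 * S + 1)) := by
        simp only [hP, Sum.elim_inl, Sum.elim_inr, Torus.proj_apply, Pi.add_apply, Pi.single_eq_same]
        push_cast
        ring
      rw [hz]
      refine le_add_natAbs_valMinAbs_of_abs_add_le hn _ (abs_le.2 ⟨?_, ?_⟩) <;> push_cast <;> omega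
    · have hv := (mem_box.1 v.2.1.2) 0
      have hw := (mem_box.1 w.2.1.2) 0
      have hz : ((P (Sum.inr v)).2.1 0 - (P (Sum.inl w)).2.1 0) =
          (((v.2.1 : Literature.Probability.LatticeModels.Site 4) 0 + n -
            (w.2.1 : Literature.Probability.LatticeModels.Site 4) 0 : ℤ) : ZMod (2 * S + 1)) := by
        simp only [hP, Sum.elim_inl, Sum.elim_inr, Torus.proj_apply, Pi.add_apply, Pi.single_eq_same]
        push_cast
        ring
      rw [hz]
      refine le_add_natAbs_valMinAbs_of_abs_sub_le hn _ (abs_le.2 ⟨?_, ?_⟩) <;> push_cast <;> omega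
    · simp at hvw
  -- the Leibniz bound of every Wick minor
  have hminor : ∀ i, ‖(Matrix.of fun a b : Fin (r i) =>
      (diracMatrix U mq)⁻¹ (quarkEquiv (P (κ i a))) (quarkEquiv (P (ρ i b)))).det‖ ≤
      ((r i).factorial : ℝ) * (ε * m₀⁻¹ ^ (r i)) := by
    intro i
    refine norm_det_le_of_card_ne _ (κ i) (ρ i) Sum.isLeft
      (Sum.elim (fun v : BoxQuarkVar Nf R => v.1) (fun v : BoxQuarkVar Nf R' => v.1)) f₀
      (inv_nonneg.2 hm₀.le) hε0 (fun a b hab => ?_) (fun a b => ?_) (fun a b hab => ?_)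
      (fun h => hch i (by rw [h, sub_self]))
    · rw [Matrix.of_apply]
      refine inv_diracMatrix_apply_eq_zero_of_fst_ne U mq ?_
      rwa [hP1, hP1]
    · rw [Matrix.of_apply]
      exact norm_inv_diracMatrix_apply_le_inv U mq hm₀ hmq _ _
    · rw [Matrix.of_apply]
      refine (norm_inv_diracMatrix_apply_le_time U mq hm₀ hmq _ _).trans ?_
      rw [mul_comm ε]
      refine mul_le_mul_of_nonneg_left ?_ (inv_nonneg.2 hm₀.le)
      rw [hε, le_div_iff₀ (pow_pos hθ0 _), ← pow_add]
      exact pow_le_pow_of_le_one hθ0.le hθ1 ((htime _ _ hab).trans_eq (add_comm _ _))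
  have hK : (∑ i, c i * (((r i).factorial : ℝ) * (ε * m₀⁻¹ ^ (r i)))) =
      (∑ i, c i * ((r i).factorial * m₀⁻¹ ^ (r i))) / θ ^ (R + R') * θ ^ n := by
    rw [hε, Finset.sum_div, Finset.sum_mul]
    refine Finset.sum_congr rfl fun i _ => ?_
    have hθRR : θ ^ (R + R') ≠ 0 := pow_ne_zero _ hθ0.ne'
    field_simp
  have h2 := h1.trans (Finset.sum_le_sum fun i _ => mul_le_mul_of_nonneg_left (hminor i) (hc i))
  rw [hK, norm_div, div_le_iff₀ (norm_pos_iff.2 hden)] at h2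
  exact h2

end Summit.QuantumFields.QCD.Cruxes.TorusHalfSpectrum.Birth.ConjugateHeavyPathwise

end
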